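import Summits.ResolutionOfSingularities.ResolutionOfSingularities.Theorems.FrobeniusLadderFRationalResolutionSurfaceSingularLocus
import Summits.ResolutionOfSingularities.ResolutionOfSingularities.Theorems.FrobeniusLadderFRationalResolutionStubRungsOfSummit
import Literature.RingTheory.TightClosure.RegularTightlyClosed
import HarnessLib

/-!
# Spreading out is free when the non-regular locus is finite
# (crux `FrobeniusLadder.FRationalResolution`, line `Sketch`)

Stubs `spreadOut_of_finite_compl_regularLocus` and `spreadOut_of_dim_le_two` of the skeleton `Sketch`
for crux stmt-ResolutionOfSingularities-15317. The strategist's `stub_spreadOut` asks, for an integral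
F-rational `X/k` (char `p`), for a proper birational INTEGRAL model `π : X' → X` with F-rational stalks
such that off a finite set every stalk of `X'` is weakly F-regular or Gorenstein. When the non-regular
locus `(Reg X)ᶜ` is already finite this is free: take `X' = X`, `π = 𝟙 X`. Indeed at a point of
`Reg X` the stalk is a regular local ring of characteristic `p` (through `X → Spec k`,
`RungsOfSummit.charP_stalk_of_over`), in which every ideal is tightly closed (Hochster–Huneke via Kunz,
`Literature.RingTheory.TightClosure.isTightlyClosed_of_isRegularLocalRing`, unfolded to the inline
weakly-F-regular clause by `isTightlyClosed_iff_of_isDomain`); so the bad set lies in `(Reg X)ᶜ`.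
In dimension `≤ 2` the non-regular locus of an integral F-rational `k`-scheme of finite type is finite
(`finite_compl_regularLocus_of_fRational_surface`), whence the corollary `spreadOut_of_dim_le_two`.
-/

-- single-problem summit: the doubled namespace component `ResolutionOfSingularities` is forced
set_option linter.dupNamespace false

noncomputable section

open CategoryTheory AlgebraicGeometry TopologicalSpace
open Literature.AlgebraicGeometry.Resolution Literature.RingTheory.TightClosure

namespace Summit.ResolutionOfSingularities.ResolutionOfSingularities.Theorems.FRationalResolution

/-- At a point of the regular locus of a scheme over a field of prime characteristic `p`, every
ideal of the stalk is tightly closed, in the route's inline form: a regular local ring is a domain of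
characteristic `p` (through `X → Spec k`) in which every ideal is tightly closed
(`isTightlyClosed_of_isRegularLocalRing`, unfolded by `isTightlyClosed_iff_of_isDomain`). -/
theorem weaklyFRegularClause_stalk_of_mem_regularLocus (p : ℕ) (hp : p.Prime) (k : Type) [Field k]
    [CharP k p] (X : Scheme.{0}) (f : X ⟶ Spec (.of k)) {x : X} (hx : x ∈ Scheme.regularLocus X)
    (I : Ideal (X.presheaf.stalk x)) (y c : X.presheaf.stalk x) (hc : c ≠ 0)
    (hy : ∀ e : ℕ, c * y ^ p ^ e ∈ Ideal.span ((fun z : X.presheaf.stalk x => z ^ p ^ e) ''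
      (I : Set (X.presheaf.stalk x)))) : y ∈ I := by
  haveI : Fact p.Prime := ⟨hp⟩
  haveI : IsRegularLocalRing (X.presheaf.stalk x) := hx
  haveI : IsDomain (X.presheaf.stalk x) := isDomain_of_isRegularLocalRing _
  haveI : CharP (X.presheaf.stalk x) p := RungsOfSummit.charP_stalk_of_over hp.ne_zero k f x
  exact (isTightlyClosed_iff_of_isDomain p).mp (isTightlyClosed_of_isRegularLocalRing p I) y c hc hy

/-- **Spreading out is free when the non-regular locus is finite.** For an integral `k`-scheme `X`
locally of finite type over a field `k` of prime characteristic `p` whose stalks satisfy the F-rational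
clause of route `FrobeniusLadder`, if `(Reg X)ᶜ` is finite then `X` itself (`π = 𝟙 X`, proper and
birational) is an integral model with F-rational stalks whose stalks are weakly F-regular (every ideal
tightly closed) or Gorenstein off a finite set: at a regular point every ideal of the stalk is tightly
closed (`weaklyFRegularClause_stalk_of_mem_regularLocus`), so the bad set lies in `(Reg X)ᶜ`. -/
theorem spreadOut_of_finite_compl_regularLocus (p : ℕ) (hp : p.Prime) (k : Type) [Field k]
    [CharP k p] (X : Scheme.{0}) (f : X ⟶ Spec (.of k)) [LocallyOfFiniteType f] [IsIntegral X]
    (hFR : ∀ x : X, IsDomain (X.presheaf.stalk x) ∧ ∀ d : ℕ, ringKrullDim (X.presheaf.stalk x) = d →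
      ∀ s : Fin d → X.presheaf.stalk x, (Ideal.span (Set.range s)).radical.IsMaximal →
      ∀ y c : X.presheaf.stalk x, c ≠ 0 →
      (∀ e : ℕ, c * y ^ p ^ e ∈ Ideal.span ((fun z : X.presheaf.stalk x => z ^ p ^ e) ''
        (Ideal.span (Set.range s) : Set (X.presheaf.stalk x)))) → y ∈ Ideal.span (Set.range s))
    (hfin : (Scheme.regularLocus X)ᶜ.Finite) :
    ∃ (X' : Scheme.{0}) (π : X' ⟶ X), IsProper π ∧ IsBirational π ∧ IsIntegral X' ∧
      (∀ x : X', IsDomain (X'.presheaf.stalk x) ∧ ∀ d : ℕ, ringKrullDim (X'.presheaf.stalk x) = d →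
        ∀ s : Fin d → X'.presheaf.stalk x, (Ideal.span (Set.range s)).radical.IsMaximal →
        ∀ y c : X'.presheaf.stalk x, c ≠ 0 →
        (∀ e : ℕ, c * y ^ p ^ e ∈ Ideal.span ((fun z : X'.presheaf.stalk x => z ^ p ^ e) ''
          (Ideal.span (Set.range s) : Set (X'.presheaf.stalk x)))) → y ∈ Ideal.span (Set.range s)) ∧
      Set.Finite {x : X' | ¬ ((∀ I : Ideal (X'.presheaf.stalk x), ∀ y c : X'.presheaf.stalk x, c ≠ 0 →
          (∀ e : ℕ, c * y ^ p ^ e ∈ Ideal.span ((fun z : X'.presheaf.stalk x => z ^ p ^ e) ''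
            (I : Set (X'.presheaf.stalk x)))) → y ∈ I) ∨
        (∀ d : ℕ, ringKrullDim (X'.presheaf.stalk x) = d → ∀ s : Fin d → X'.presheaf.stalk x,
          (Ideal.span (Set.range s)).radical.IsMaximal →
          ∃ t : X'.presheaf.stalk x, (Ideal.span (Set.range s)).colon
            (IsLocalRing.maximalIdeal (X'.presheaf.stalk x) : Set (X'.presheaf.stalk x)) =
            Ideal.span (Set.range s) ⊔ Ideal.span {t}))} := by
  refine ⟨X, 𝟙 X, inferInstance, ⟨⊤, by simp [dense_univ], by simp [dense_univ], inferInstance⟩,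
    ‹IsIntegral X›, hFR, hfin.subset fun x hx hreg => hx (Or.inl fun I y c hc hy => ?_)⟩
  exact weaklyFRegularClause_stalk_of_mem_regularLocus p hp k X f hreg I y c hc hy

/-- **Spreading out is free for F-rational surfaces.** For an integral `k`-scheme `X` of finite type
over a field `k` of prime characteristic `p`, of dimension `≤ 2`, whose stalks satisfy the F-rational
clause of route `FrobeniusLadder`, `X` itself (`π = 𝟙 X`) is a proper birational integral model with
F-rational stalks whose stalks are weakly F-regular or Gorenstein off a finite set: the non-regular
locus of an integral F-rational surface is finite (`finite_compl_regularLocus_of_fRational_surface`),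
so `spreadOut_of_finite_compl_regularLocus` applies. -/
theorem spreadOut_of_dim_le_two (p : ℕ) (hp : p.Prime) (k : Type) [Field k]
    [CharP k p] (X : Scheme.{0}) (f : X ⟶ Spec (.of k)) [LocallyOfFiniteType f] [QuasiCompact f]
    [IsIntegral X]
    (hFR : ∀ x : X, IsDomain (X.presheaf.stalk x) ∧ ∀ d : ℕ, ringKrullDim (X.presheaf.stalk x) = d →
      ∀ s : Fin d → X.presheaf.stalk x, (Ideal.span (Set.range s)).radical.IsMaximal →
      ∀ y c : X.presheaf.stalk x, c ≠ 0 →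
      (∀ e : ℕ, c * y ^ p ^ e ∈ Ideal.span ((fun z : X.presheaf.stalk x => z ^ p ^ e) ''
        (Ideal.span (Set.range s) : Set (X.presheaf.stalk x)))) → y ∈ Ideal.span (Set.range s))
    (hdim : topologicalKrullDim X ≤ 2) :
    ∃ (X' : Scheme.{0}) (π : X' ⟶ X), IsProper π ∧ IsBirational π ∧ IsIntegral X' ∧
      (∀ x : X', IsDomain (X'.presheaf.stalk x) ∧ ∀ d : ℕ, ringKrullDim (X'.presheaf.stalk x) = d →
        ∀ s : Fin d → X'.presheaf.stalk x, (Ideal.span (Set.range s)).radical.IsMaximal →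
        ∀ y c : X'.presheaf.stalk x, c ≠ 0 →
        (∀ e : ℕ, c * y ^ p ^ e ∈ Ideal.span ((fun z : X'.presheaf.stalk x => z ^ p ^ e) ''
          (Ideal.span (Set.range s) : Set (X'.presheaf.stalk x)))) → y ∈ Ideal.span (Set.range s)) ∧
      Set.Finite {x : X' | ¬ ((∀ I : Ideal (X'.presheaf.stalk x), ∀ y c : X'.presheaf.stalk x, c ≠ 0 →
          (∀ e : ℕ, c * y ^ p ^ e ∈ Ideal.span ((fun z : X'.presheaf.stalk x => z ^ p ^ e) ''
            (I : Set (X'.presheaf.stalk x)))) → y ∈ I) ∨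
        (∀ d : ℕ, ringKrullDim (X'.presheaf.stalk x) = d → ∀ s : Fin d → X'.presheaf.stalk x,
          (Ideal.span (Set.range s)).radical.IsMaximal →
          ∃ t : X'.presheaf.stalk x, (Ideal.span (Set.range s)).colon
            (IsLocalRing.maximalIdeal (X'.presheaf.stalk x) : Set (X'.presheaf.stalk x)) =
            Ideal.span (Set.range s) ⊔ Ideal.span {t}))} := by
  haveI : IsNoetherian X := Scheme.isNoetherian_of_finiteType_over_field f
  exact spreadOut_of_finite_compl_regularLocus p hp k X f hFR
    (finite_compl_regularLocus_of_fRational_surface p hp k X f hFR hdim)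

end Summit.ResolutionOfSingularities.ResolutionOfSingularities.Theorems.FRationalResolution

end
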